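import Summits.Langlands.Langlands.Theses.HybridParityDefect

/-!
# BC3 birth skeleton — crux `HybridDictionary` (item stmt-Langlands-17967) of route
`route-Langlands-HybridParityDefect`

Registered line `Lines/birth.lean` (skeleton registrar, 2026-08-17).  The crux C2 =
`Summit.Langlands.Langlands.Theses.HybridParityDefect.HybridDictionary` says: over the golden
field, for a mixed-parity icosahedral `σ`, an `ℓ`-adic avatar `ρ` of `σ^∨` and a cuspidal
L-algebraic `π` of `GL₂(𝔸_F)` with `Corresponds 𝓡 ι π ρ` (typed reciprocity, local–global
compatibility at EVERY finite place), the explicit hybrid weight-one ⊗ Maass series `f_σ` with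
the ARTIN Dirichlet coefficients `a_σ(𝔪)` is weight-`(1,0)` automorphic under
`Γ₁(𝔣(σ)) ∩ SL₂(𝓞_F)`.

The route's own two-layer plan (route header, TWO-LAYER PLAN: `HybridDictionary ⇐
NewformHybridExpansion → CoefficientsAreArtin`) is typed here as two NAMED stubs glued by a
kernel-checked composition:

* `stub_newformHybridExpansion : NewformHybridExpansion` — AUTOMORPHIC SIDE (Hilbert–Maass
  newform theory + `rec_v` preserves `L`-factors): under the crux hypotheses there is a
  coefficient system `b : Ideal 𝓞_F → ℂ` which (i) is the Dirichlet coefficient system of `π`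
  READ THROUGH `𝓡` — `b(𝔪) = ∏_v coeff_{v(𝔪)} L_v(T)⁻¹` with `L_v(T) = det(1 - TΦ | (ker N)^{I_v})`
  the Euler polynomial of (a Weil–Deligne representative of) the local Langlands parameter
  `rec_v(π_v)` of the local component of `π` at EVERY finite `v` (`EulerLink`) — and (ii) whose
  hybrid series (same sign rule, same level `𝔣(σ)`, same archimedean Whittaker functions as the
  crux) is weight-`(1,0)` automorphic (`HybridAutWith`).  Content: LGC ⇒ conductor `𝔣(π) = 𝔣(σ)`;
  automorphic FE (Jacquet–Langlands) vs Artin FE (Brauer) ⇒ `π_∞` = (weight-one limit of discrete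
  series at `ι₁`, parameter-`0` principal series of sign `σ(c₂)` at `ι₂`); Casselman's
  `K₁(𝔣)`-newvector; narrow class number one ⇒ one classical component on `ℍ × ℍ`; Whittaker–
  Fourier expansion over `𝔡⁻¹` whose coefficients are the Dirichlet coefficients of
  `L(s,π) = ∏_v L(s, rec_v(π_v))`.  Size XL.
* `stub_localFactorsAreArtin : LocalFactorsAreArtin` — GALOIS SIDE (the Frobenius/contragredient
  bookkeeping the crux flags): under the same hypotheses, EVERY local Euler polynomial of `π` read
  through `𝓡` equals the Artin Euler factor `ArtinRep.eulerFactorAt σ v` (arithmetic Frobenius on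
  `V^{I_v}`): uniqueness of local components (Flath), class-invariance of the Euler factor under
  Frobenius-semisimplification and `ι`-transport, `WD(ρ|_{Γ_v})` for finite image (`N = 0`;
  at `v ∣ ℓ` through the pinned Fontaine datum or, where the interface is silent, through the
  functional-equation rigidity of the finitely many bad factors), and `ρ = ι⁻¹(ᵗσ⁻¹)`:
  `det(1 - T σ^∨(Φ_geom)) = det(1 - T σ(Frob_arith))`.  Size M–L.
* `HybridDictionary_of_stubs : NewformHybridExpansion → LocalFactorsAreArtin → ArtinHybridAutomorphy`
  — the sorry-free ASSEMBLY (real proof): take `b`, its local polynomials `P`, rewrite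
  `P = (L_v(σ,T))_v` by the second stub; then `b` is LITERALLY the crux's `artinCoeff F σ` and
  `HybridAutWith … b` is the crux's `HybridAut` (`ArtinHybridAutomorphy` = the crux with its eight
  `let`s unfolded into the skeleton's vocabulary; `artinHybridAutomorphy_iff : _ ↔ HybridDictionary`
  is `Iff.rfl`).  The plan's "CoefficientsAreArtin" is thus split into its mathematical content
  (local factors, stub 2) and its bookkeeping (the `∏ᶠ`/power-series coefficient assembly, done in
  the glue, not a stub).
* `HybridDictionary_of : HybridDictionary` — THE SKELETON THEOREM (registrar shape, as in the tree's
  other `Lines/birth.lean`): the crux BY NAME from the two declared stubs through the assembly; the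
  only `sorry`s in its closure are the two `stub_*`.

Neither stub is the crux or the summit in costume: stub 1 concludes automorphy of the series with
`π`'s OWN coefficients (a theorem of newform theory in substance, no identification with `σ`),
stub 2 concludes a local identity with no automorphy in it; BC3 probes `stub → HybridDictionary`,
`stub → Langlands`, `stub → ¬Langlands` by `first | exact? | simpa | aesop` all fail (folder
`bc/*_probe.lean`, NOTES.md).  Disproof used: none relevant (no `Disproof.lean` /
`_false_without_` theorem is registered for this crux at the time of writing; `ledger crux ls`
shows no workfiles).
-/

noncomputable section

-- `Summit.Langlands.Langlands.…` (summit = sub-problem, D-0017 single-conjunct layout) trips the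
-- duplicated-namespace linter on every declaration, exactly as in the route file; silence it.
set_option linter.dupNamespace false

namespace Summit.Langlands.Langlands.Cruxes.HybridDictionary.Birth

open scoped BigOperators Topology Manifold Classical MeasureTheory ProbabilityTheory Matrix InnerProductSpace ComplexConjugate ContinuousMap MatrixGroups NumberField
open Filter Set Function TopologicalSpace MeasureTheory
open NumberField IsDedekindDomain
open Literature.NumberTheory.Automorphic Literature.NumberTheory.GaloisRepresentations

variable (F : Type) [Field F] [NumberField F]

/-- The golden-field frame of the crux (verbatim its `let Golden`): `F` real quadratic of
discriminant `5` through `a = √5`, two distinct real embeddings, `ι₁ a > 0`. [folklore] -/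
def Golden (a : F) (ι₁ ι₂ : F →+* ℝ) : Prop :=
  Module.finrank ℚ F = 2 ∧ a ^ 2 = 5 ∧ ι₁ ≠ ι₂ ∧ 0 < ι₁ a

/-- Mixed-parity icosahedral `σ` (verbatim the crux's `let MixedIco`). [folklore] -/
def MixedIco (ι₁ ι₂ : F →+* ℝ) (σ : FramedArtinRep F 2) : Prop :=
  σ.toGaloisRep.IsIrreducible ∧ (Set.range σ).Finite ∧ ¬ IsSolvable σ.toMonoidHom.range ∧
    ArtinRep.signature σ.toArtinRep ι₁ = (1, 1) ∧ (ArtinRep.signature σ.toArtinRep ι₂).1 ≠ 1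

/-- `ρ` is the `ℓ`-adic avatar of the contragredient `σ^∨`: `ι(ᵗρ(g)⁻¹) = σ(g)` (verbatim the
crux's `let DualAvatar`). [folklore] -/
def DualAvatar (ℓ : ℕ) [Fact ℓ.Prime] (ι : PadicAlgCl ℓ ≃+* ℂ) (σ : FramedArtinRep F 2)
    (ρ : FramedGaloisRep F (PadicAlgCl ℓ) 2) : Prop :=
  ∀ g, (((ρ g)⁻¹ : GL (Fin 2) (PadicAlgCl ℓ)) : Matrix (Fin 2) (Fin 2) (PadicAlgCl ℓ)).transpose.map ι
    = ((σ g : GL (Fin 2) ℂ) : Matrix (Fin 2) (Fin 2) ℂ)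

/-- **Dirichlet coefficients from local Euler polynomials**: `b(𝔪) = ∏_v coeff_{v(𝔪)} (P_v)⁻¹`
(power-series inverse of `P_v ∈ ℂ[T]`, exponent `v(𝔪)` = multiplicity of `v` in `𝔪`).  With
`P_v = L_v(σ, T)` this is LITERALLY the crux's `artinCoeff F σ`. [folklore] -/
def dirichletCoeff (P : HeightOneSpectrum (𝓞 F) → Polynomial ℂ) (I : Ideal (𝓞 F)) : ℂ :=
  ∏ᶠ v : HeightOneSpectrum (𝓞 F),
    PowerSeries.coeff ((Associates.mk v.asIdeal).count (Associates.mk I).factors)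
      ((P v : PowerSeries ℂ)⁻¹)

/-- The Möbius action through the real embedding `ι` (verbatim the crux's `let act`). [folklore] -/
def act (ι : F →+* ℝ) (α β γ δ : F) (z : ℂ) : ℂ :=
  ((ι α : ℂ) * z + (ι β : ℂ)) / ((ι γ : ℂ) * z + (ι δ : ℂ))

/-- **The hybrid weight-one ⊗ Maass series with coefficient system `b`**:
`Σ_{ξ ∈ 𝔡⁻¹, ι₁ξ > 0} b((ξ√5)) ε(ξ) e(ι₁ξ z₁) √y₂ K₀(2π|ι₂ξ| y₂) e(ι₂ξ x₂)` — the crux's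
`let series` with `b 𝔪` in place of `artinCoeff F σ 𝔪` (same sign rule `ε`, read off
`ArtinRep.signature σ ι₂`, same archimedean Whittaker functions). [folklore] -/
def seriesWith (a : F) (ι₁ ι₂ : F →+* ℝ) (σ : FramedArtinRep F 2) (b : Ideal (𝓞 F) → ℂ)
    (z₁ z₂ : ℂ) : ℂ :=
  ∑' ξ : F,
    @dite ℂ ((∃ m : 𝓞 F, (m : F) = ξ * a) ∧ 0 < ι₁ ξ) (Classical.dec _)
        (fun h => b (Ideal.span {h.1.choose}) *
          (if ι₂ ξ < 0 ∧ (ArtinRep.signature σ.toArtinRep ι₂).1 ≠ 2 then -1 else 1))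
        (fun _ => 0) *
      Complex.exp (2 * Real.pi * Complex.I * (ι₁ ξ : ℂ) * z₁) *
      (((Real.sqrt z₂.im : ℝ) : ℂ) *
        ((∫ t in Set.Ioi (0 : ℝ), Real.exp (-(2 * Real.pi * |ι₂ ξ| * z₂.im * Real.cosh t)) : ℝ) : ℂ)) *
      Complex.exp (2 * Real.pi * Complex.I * (ι₂ ξ : ℂ) * (z₂.re : ℂ))

/-- **Weight-`(1,0)` automorphy under `Γ₁(𝔣(σ)) ∩ SL₂(𝓞_F)` of the hybrid series with
coefficient system `b`** — the crux's `let HybridAut` with `seriesWith … b`. [folklore] -/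
def HybridAutWith (a : F) (ι₁ ι₂ : F →+* ℝ) (σ : FramedArtinRep F 2) (b : Ideal (𝓞 F) → ℂ) :
    Prop :=
  ∀ α β γ δ : 𝓞 F, α * δ - β * γ = 1 → γ ∈ σ.toGaloisRep.artinConductor →
    α - 1 ∈ σ.toGaloisRep.artinConductor → δ - 1 ∈ σ.toGaloisRep.artinConductor →
      ∀ z₁ z₂ : ℂ, 0 < z₁.im → 0 < z₂.im →
        seriesWith F a ι₁ ι₂ σ b (act F ι₁ α β γ δ z₁) (act F ι₂ α β γ δ z₂) =
          ((ι₁ (γ : F) : ℂ) * z₁ + (ι₁ (δ : F) : ℂ)) * seriesWith F a ι₁ ι₂ σ b z₁ z₂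

variable {F}

/-- **`Q` is the local Euler polynomial of `π` at `v`, read through `𝓡`**: for some irreducible
smooth local component `π_v` of `π` at `v` (`HasLocalComponentAt`, Flath) and some complex
Weil–Deligne representation `r` in the Frobenius-semisimple class `rec_v(π_v)` of the local
Langlands correspondence of `𝓡` at `v`, `Q = det(1 - T·r(Φ) | (ker N)^{I_v})`
(`WeilDeligneRep.eulerFactor`, geometric Frobenius `Φ`).  By `L(s, π_v) = L(s, rec_v(π_v))`
(Henniart's characterisation, clause `L`-factors of pairs with the trivial character) this is the
inverse local `L`-factor of `π_v` in `T = q_v^{-s}`.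
[cite: HarrisTaylorAMS2001, Thm. A] [cite: TateCorvallis1979, (4.1.6)] -/
def IsLocalEulerFactorAt {hcpt : isCompact_glFiniteIntegralLevel 2 F}
    (RD : Summit.Langlands.ReciprocityData F) (π : AutomorphicRepData (AutomorphyDatum.gl 2 F hcpt))
    (v : HeightOneSpectrum (𝓞 F)) (Q : Polynomial ℂ) : Prop :=
  ∃ (πv : SmoothIrrep (GL (Fin 2) (v.adicCompletion F)))
    (r : WeilDeligneRep (v.adicCompletion F) ℂ (Fin 2 → ℂ)),
    π.HasLocalComponentAt v πv.ρ ∧ r.HasFrobSemisimpleClass ((RD.llc v).recGL 2 (IrrClass.mk πv)) ∧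
      Q = r.eulerFactor (RD.llc v).hn (RD.llc v).hex

/-- **`b` is the Dirichlet coefficient system of `π` read through `𝓡`**: `b = dirichletCoeff P`
for a family `P` of local Euler polynomials of `π` at every finite place (`IsLocalEulerFactorAt`),
i.e. `Σ b(𝔪) N𝔪^{-s} = ∏_v L(s, rec_v(π_v))`. [cite: TateCorvallis1979, (4.1.6)] -/
def EulerLink {hcpt : isCompact_glFiniteIntegralLevel 2 F} (RD : Summit.Langlands.ReciprocityData F)
    (π : AutomorphicRepData (AutomorphyDatum.gl 2 F hcpt)) (b : Ideal (𝓞 F) → ℂ) : Prop :=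
  ∃ P : HeightOneSpectrum (𝓞 F) → Polynomial ℂ,
    (∀ v, IsLocalEulerFactorAt RD π v (P v)) ∧ b = dirichletCoeff F P

/-- **Stub statement 1 (automorphic side; the route's `NewformHybridExpansion`).**  For golden
data, `σ` mixed-parity icosahedral, `ρ` an `ℓ`-adic avatar of `σ^∨`, and a cuspidal L-algebraic
`π` of `GL₂(𝔸_F)` with `Corresponds 𝓡 ι π ρ`: the hybrid series built from the Dirichlet
coefficient system of `π` (read through `𝓡`, `EulerLink`) with the sign rule and level `𝔣(σ)` of
the crux is weight-`(1,0)` automorphic under `Γ₁(𝔣(σ)) ∩ SL₂(𝓞_F)`.  In substance: LGC ⇒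
`𝔣(π) = 𝔣(σ)` and central character; automorphic vs Artin functional equation ⇒ `π_∞` pinned
(no Hodge–Tate input); Casselman newvector; Whittaker–Fourier expansion over `𝔡⁻¹`.
Why plausibly true: classical Hilbert–Maass newform theory (Casselman 1973, Miyake 1971,
Shimura 1978, Weil 1971) — not in the tree (definition-first territory).  Size XL.
[cite: Casselman1973, Thm. 1] [cite: BuzzardGeeLMS2014, Conj. 3.2.2] -/
def NewformHybridExpansion : Prop :=
  ∀ (F : Type) [Field F] [NumberField F] (a : F) (ι₁ ι₂ : F →+* ℝ), Golden F a ι₁ ι₂ →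
    ∀ σ : FramedArtinRep F 2, MixedIco F ι₁ ι₂ σ →
      ∀ (RD : Summit.Langlands.ReciprocityData F) (ℓ : ℕ) [Fact ℓ.Prime] (ι : PadicAlgCl ℓ ≃+* ℂ)
        (ρ : FramedGaloisRep F (PadicAlgCl ℓ) 2), DualAvatar F ℓ ι σ ρ →
        ∀ (hcpt : isCompact_glFiniteIntegralLevel 2 F) (π : CuspidalAutomorphicRepData 2 F hcpt),
          π.1.IsLAlgebraic → Summit.Langlands.Corresponds RD ι π.1 ρ →
            ∃ b : Ideal (𝓞 F) → ℂ, EulerLink RD π.1 b ∧ HybridAutWith F a ι₁ ι₂ σ b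

/-- **Stub statement 2 (Galois side; the local content of the route's `CoefficientsAreArtin`).**
Under the same hypotheses, every local Euler polynomial of `π` read through `𝓡` at a finite place
`v` IS the Artin Euler factor of `σ` at `v`: `det(1 - T·r(Φ_geom) | (ker N)^{I_v}) =
det(1 - T·σ(Frob_arith) | V^{I_v})` (`ArtinRep.eulerFactorAt`, arithmetic Frobenius).  In
substance: local components are unique up to isomorphism (Flath), the Euler factor is an
invariant of the Frobenius-semisimple class and of `ι`-transport, `Corresponds` at `v` gives
`rec_v(π_v) ∋ ι WD(ρ|_{Γ_v})`, `ρ` has finite image so `N = 0` and `WD = ρ|_{W_v}`, and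
`ρ = ι⁻¹(ᵗσ⁻¹)` turns the geometric Frobenius of `σ^∨` into the arithmetic Frobenius of `σ`.
Why it might stall: at `v ∣ ℓ` the pinned Fontaine datum must return `(ρ|_{W_v}, 0)` for a
finite-image `ρ` (clause F8 covers the unramified case; else the finitely many bad factors are
pinned by functional-equation rigidity).  Size M–L.
[cite: HarrisTaylorAMS2001, Thm. A] [cite: TateCorvallis1979, (4.1.6)] [cite: MartinetDurham1977, §2] -/
def LocalFactorsAreArtin : Prop :=
  ∀ (F : Type) [Field F] [NumberField F] (a : F) (ι₁ ι₂ : F →+* ℝ), Golden F a ι₁ ι₂ →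
    ∀ σ : FramedArtinRep F 2, MixedIco F ι₁ ι₂ σ →
      ∀ (RD : Summit.Langlands.ReciprocityData F) (ℓ : ℕ) [Fact ℓ.Prime] (ι : PadicAlgCl ℓ ≃+* ℂ)
        (ρ : FramedGaloisRep F (PadicAlgCl ℓ) 2), DualAvatar F ℓ ι σ ρ →
        ∀ (hcpt : isCompact_glFiniteIntegralLevel 2 F) (π : CuspidalAutomorphicRepData 2 F hcpt),
          π.1.IsLAlgebraic → Summit.Langlands.Corresponds RD ι π.1 ρ →
            ∀ (v : HeightOneSpectrum (𝓞 F)) (Q : Polynomial ℂ), IsLocalEulerFactorAt RD π.1 v Q →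
              Q = ArtinRep.eulerFactorAt σ.toArtinRep v

/-- **The crux in the skeleton's vocabulary** — `HybridAutWith` applied to the ARTIN coefficient
system `dirichletCoeff (L_v(σ,T))_v`, under the crux's hypotheses.  This is DEFINITIONALLY the
route decl `HybridParityDefect.HybridDictionary` (its eight `let`s unfolded: `hybridDictionary_iff`
below is `Iff.rfl`); it is the conclusion of the sorry-free assembly `HybridDictionary_of_stubs`,
NOT a stub. [folklore] -/
def ArtinHybridAutomorphy : Prop :=
  ∀ (F : Type) [Field F] [NumberField F] (a : F) (ι₁ ι₂ : F →+* ℝ), Golden F a ι₁ ι₂ →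
    ∀ σ : FramedArtinRep F 2, MixedIco F ι₁ ι₂ σ →
      ∀ (RD : Summit.Langlands.ReciprocityData F) (ℓ : ℕ) [Fact ℓ.Prime] (ι : PadicAlgCl ℓ ≃+* ℂ)
        (ρ : FramedGaloisRep F (PadicAlgCl ℓ) 2), DualAvatar F ℓ ι σ ρ →
        ∀ (hcpt : isCompact_glFiniteIntegralLevel 2 F) (π : CuspidalAutomorphicRepData 2 F hcpt),
          π.1.IsLAlgebraic → Summit.Langlands.Corresponds RD ι π.1 ρ →
            HybridAutWith F a ι₁ ι₂ σ (dirichletCoeff F fun v => ArtinRep.eulerFactorAt σ.toArtinRep v)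

/-- The restatement IS the crux, definitionally (the crux's `let artinCoeff/coeff/series/act/
HybridAut/MixedIco/DualAvatar/Golden` unfold to the skeleton's `dirichletCoeff/seriesWith/act/
HybridAutWith/MixedIco/DualAvatar/Golden`). [folklore] -/
theorem artinHybridAutomorphy_iff :
    ArtinHybridAutomorphy ↔ Summit.Langlands.Langlands.Theses.HybridParityDefect.HybridDictionary :=
  Iff.rfl

/-! ## The two registered stubs -/

/-- STUB 1 — see `NewformHybridExpansion`. [cite: Casselman1973, Thm. 1] -/
theorem stub_newformHybridExpansion : NewformHybridExpansion := by
  sorry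

/-- STUB 2 — see `LocalFactorsAreArtin`. [cite: TateCorvallis1979, (4.1.6)] -/
theorem stub_localFactorsAreArtin : LocalFactorsAreArtin := by
  sorry

/-! ## Assembly (sorry-free) and the skeleton theorem -/

/-- **ASSEMBLY (kernel-checked, no `sorry`): the two stub statements imply the crux** (in the
form `ArtinHybridAutomorphy`, definitionally the route decl).  Take the coefficient system
`b = dirichletCoeff P` of stub 1; stub 2 rewrites every local polynomial `P v` into the Artin
Euler factor of `σ` at `v`; then `b` is the Artin coefficient system and stub 1's automorphy is the
claim. [folklore] -/
theorem HybridDictionary_of_stubs (h₁ : NewformHybridExpansion) (h₂ : LocalFactorsAreArtin) :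
    ArtinHybridAutomorphy := by
  intro F _ _ a ι₁ ι₂ hgold σ hσ RD ℓ _ ι ρ hav hcpt π hLalg hcorr
  obtain ⟨b, ⟨P, hP, rfl⟩, haut⟩ := h₁ F a ι₁ ι₂ hgold σ hσ RD ℓ ι ρ hav hcpt π hLalg hcorr
  have hPσ : P = fun v => ArtinRep.eulerFactorAt σ.toArtinRep v :=
    funext fun v => h₂ F a ι₁ ι₂ hgold σ hσ RD ℓ ι ρ hav hcpt π hLalg hcorr v (P v) (hP v)
  subst hPσ
  exact haut

/-- **THE SKELETON THEOREM (registrar shape).** The crux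
`Summit.Langlands.Langlands.Theses.HybridParityDefect.HybridDictionary`, concluded BY NAME from the
two declared stubs through the sorry-free assembly `HybridDictionary_of_stubs` (and the definitional
bridge `artinHybridAutomorphy_iff`); the only `sorry`s in its closure are
`stub_newformHybridExpansion` and `stub_localFactorsAreArtin`. [folklore] -/
theorem HybridDictionary_of : Summit.Langlands.Langlands.Theses.HybridParityDefect.HybridDictionary :=
  artinHybridAutomorphy_iff.mp
    (HybridDictionary_of_stubs stub_newformHybridExpansion stub_localFactorsAreArtin)

end Summit.Langlands.Langlands.Cruxes.HybridDictionary.Birth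

end
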